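import Summits.HodgeConjecture.HodgeConjecture.Theorems.MarkmanPartnerTransportPicardThreeK3SquaresRealMultiplicationRanks
import Summits.HodgeConjecture.HodgeConjecture.Theorems.MarkmanPartnerTransportPicardThreeK3SquaresSquareOfGenerator

/-!
# Route MarkmanPartnerTransport · crux `PicardThreeK3Squares` (stmt-HodgeConjecture-19652) —
# ONE CYCLE SUFFICES, part 1: the algebra (prime degree), `N¹`-stability, and the `N¹`-stable rung F4

Cell hodge-nonav, crux #4 of route MarkmanPartnerTransport (HC⁴(S ⊗ S) for projective K3 surfaces with
ρ(S) ≥ 3; open core: real multiplication). Varesco's bookkeeping (tree: `SectorIff`,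
`CycleInducedSector`, F4 `SquareOfGenerator`) says HC⁴(S ⊗ S) ⟺ EVERY element of
`E = End_Hdg(T(S)_ℚ)` is induced by an algebraic class on `S × S`, and every landed sector supplies ALL
of `E` (CM; `E = ℚ`; the van Geemen–Schütt families via a cycle-induced GENERATOR with the typed clause
`TranscendentalEndomorphismsGeneratedBy`). The line «one cycle suffices» (prover 19652-p1 g8) removes
the generation clause wherever arithmetic allows: cycle-induced elements of `E` form a `ℚ`-subalgebra,
hence a subfield of the field `E` (Zarhin); van Geemen's Lemma 3.2 (`dim_ℚ T = [E:ℚ] · m`, `m ≥ 3`,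
tree theorem) forces `[E:ℚ] ∈ {1} ∪ {primes}` unless `22 - ρ(S) ∈ {12, 16, 18, 20}`; and in prime
degree a non-scalar element generates. This file carries the route-independent bricks:

* `exists_eq_aeval_of_finrank_prime` — in a domain of prime dimension over `ℚ`, every element is a
  rational polynomial in any non-scalar element (`Subalgebra.isSimpleOrder_of_finrank_prime`).
* `prime_of_mul_add_eq` — `d · m + ρ = 22`, `d ≥ 2`, `m ≥ 3`, `ρ ∉ {2, 4, 6, 10}` ⟹ `d` prime.
* `isDomain_endAlg_of_isField`, `exists_eq_aeval_of_totallyReal` — on the abstract carriers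
  (`HodgeStructure V 2` irreducible of K3 type, polarized, `End_Hdg` a totally real field, `dim V = d·m`
  with `m ≥ 3` only for prime `d`): `End_Hdg(V) = ℚ[r]` for every non-scalar `r ∈ End_Hdg(V)`.
* `mapsTo_algebraicClasses_one` — a rational, type-preserving endomorphism of `H²(S)` maps `N¹H²`
  into itself (Lefschetz `(1,1)`), for every smooth projective surface `S`.
* `hodgeConjectureFor_square_of_generatedBy_of_mapsTo` — rung F4 `SquareOfGenerator` with "`t` kills
  `N¹`" weakened to "`t` maps `N¹` into `N¹`": an `N¹`-stable cycle-induced `t` with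
  `TranscendentalEndomorphismsGeneratedBy S t` gives `HodgeConjectureFor 4 (S ⊗ S)`.

Sequel: `Theorems/MarkmanPartnerTransportPicardThreeK3SquaresOneCycle` (one endomorphism with an
irrational `(2,0)`-eigenvalue generates `End_Hdg(T(S))` or `S` is CM; the Hodge conjecture for `S ⊗ S`
from ONE cycle). No definition, no sorry, no named-fact hypothesis. Prover seat hodge-nonav-19652-p1
(gen 8), `--supports stmt-HodgeConjecture-19652`. Nothing here proves the crux or the Hodge conjecture.

References: van Geemen, Michigan Math. J. 56 (2008), Lemma 3.2; Zarhin, J. reine angew. Math. 341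
(1983), Thm. 1.5.1; Varesco, Math. Z. 305 (2023), §2 (p. 8); van Geemen–Schütt, Forum Math. Sigma 13
(2025) e2, §2.1, §4.8, Rem. 4.9; Fulton, *Intersection Theory*, Prop. 16.1.1; Voisin, *Hodge Theory
and Complex Algebraic Geometry I*, Thm. 11.30.
-/

set_option linter.dupNamespace false

noncomputable section

universe u

namespace Summit.HodgeConjecture.HodgeConjecture.Theorems.MarkmanPartnerTransport.OneCycle

open scoped Manifold TensorProduct
open Module CategoryTheory MonoidalCategory CartesianMonoidalCategory Polynomial
open Literature.AlgebraicGeometry Literature.AlgebraicGeometry.Motives Literature.AlgebraicGeometry.HodgeTheory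
open Literature.AlgebraicGeometry.Motives.HodgeStructure
open Literature.AlgebraicGeometry.Surfaces
open Literature.AlgebraicTopology.SingularHomology
open Summit.HodgeConjecture.HodgeConjecture.Theorems
open Summit.HodgeConjecture.HodgeConjecture.Theorems.NikulinTwinTransport
open Summit.HodgeConjecture.HodgeConjecture.Theorems.AnchorExistenceCMFloor
open Summit.HodgeConjecture.HodgeConjecture.Theorems.MarkmanPartnerTransport.RealMultiplicationRanks

/-- `Corr[μ, hS ; γ, y] = pr₁_*(pr₂^* y ∪ γ)` on `H²(S(ℂ); ℂ)`. Local notation only. -/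
local notation3 (prettyPrint := false) "Corr[" μ ", " hS " ; " γ ", " y "]" =>
  complexGysin μ (IsSmoothProjective.tensor_holds hS hS) hS
    (SemiCartesianMonoidalCategory.fst _ _) (rfl : 2 * 1 + 2 * 2 + 2 * 2 = 2 * 1 + 2 * (2 + 2))
    (cupProduct (rfl : 2 * 1 + 2 * 2 = 2 * 1 + 2 * 2)
      (complexBetti.map (SemiCartesianMonoidalCategory.snd _ _) (2 * 1) y) γ)

/-! ### Algebra: a non-scalar element generates an algebra of prime dimension -/

/-- **In a domain `E` of prime dimension over `ℚ`, every element is a rational polynomial in any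
non-scalar element `r`**: the subalgebra `ℚ[r]` is `⊥` or `⊤` (`Subalgebra.isSimpleOrder_of_finrank_prime`),
not `⊥` since `r ∉ ℚ`, and `ℚ[r]` is the range of `aeval r`. [folklore] -/
theorem exists_eq_aeval_of_finrank_prime {E : Type*} [Ring E] [IsDomain E] [Algebra ℚ E]
    (hp : (Module.finrank ℚ E).Prime) {r : E} (hr : r ∉ (⊥ : Subalgebra ℚ E)) (s : E) :
    ∃ P : ℚ[X], s = aeval r P := by
  haveI := Subalgebra.isSimpleOrder_of_finrank_prime ℚ E hp
  rcases IsSimpleOrder.eq_bot_or_eq_top (Algebra.adjoin ℚ {r}) with h | h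
  · exact absurd (h ▸ Algebra.self_mem_adjoin_singleton ℚ r) hr
  · have hs : s ∈ Algebra.adjoin ℚ {r} := h ▸ Algebra.mem_top
    rw [Algebra.adjoin_singleton_eq_range_aeval, AlgHom.mem_range] at hs
    obtain ⟨P, hP⟩ := hs
    exact ⟨P, hP.symm⟩

/-- **The Picard numbers at which `[E:ℚ]` is forced to be `1` or a prime**: if `d · m + ρ = 22` with
`d ≥ 2`, `m ≥ 3` and `ρ ∉ {2, 4, 6, 10}` then `d` is prime (`22 - ρ ∉ {20, 18, 16, 12}` rules out the
composite divisors `4, 6` with cofactor `≥ 3`; `d ≤ 7`). [cite: Vangeemen2008, Lemma 3.2]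
[cite: GeemenSchutt2023, §2.1] -/
theorem prime_of_mul_add_eq {ρ d m : ℕ} (h2 : ρ ≠ 2) (h4 : ρ ≠ 4) (h6 : ρ ≠ 6) (h10 : ρ ≠ 10)
    (hd : 2 ≤ d) (hm : 3 ≤ m) (h : d * m + ρ = 22) : d.Prime := by
  have hd7 : d ≤ 7 := by nlinarith
  interval_cases d
  · exact Nat.prime_two
  · exact Nat.prime_three
  · exfalso; omega
  · exact Nat.prime_five
  · exfalso; omega
  · exact (by norm_num : Nat.Prime 7)

/-! ### Abstract carriers: `E = ℚ[r]` for a non-scalar `r` when `[E:ℚ]` is forced prime -/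

section Abstract

variable {V : Type u} [AddCommGroup V] [Module ℚ V] [Module.Finite ℚ V] {H : HodgeStructure V 2}

omit [Module.Finite ℚ V] in
/-- The endomorphism algebra of a Hodge structure, when it is a field (Zarhin), is a domain (no
`Field` instance is put on the subalgebra: zero divisors are excluded by hand from `IsField`). [folklore] -/
theorem isDomain_endAlg_of_isField (hF : IsField H.endAlg) : IsDomain H.endAlg := by
  haveI : Nontrivial H.endAlg := ⟨hF.exists_pair_ne⟩
  haveI : NoZeroDivisors H.endAlg := ⟨fun {a b} hab => by
    by_cases ha : a = 0
    · exact Or.inl ha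
    · obtain ⟨c, hc⟩ := hF.mul_inv_cancel ha
      refine Or.inr ?_
      calc b = (a * c) * b := by rw [hc, one_mul]
        _ = c * (a * b) := by rw [hF.mul_comm a c, mul_assoc]
        _ = 0 := by rw [hab, mul_zero]⟩
  exact NoZeroDivisors.to_isDomain _

/-- **`End_Hdg(V) = ℚ[r]` for any non-scalar Hodge endomorphism `r`, when the rank forces prime
degree**: for `H` irreducible of K3 type, polarized, with `E = End_Hdg(V)` a totally real field, and
`dim_ℚ V = d · m` with `d ≥ 2`, `m ≥ 3` only for prime `d`: van Geemen's Lemma 3.2 gives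
`dim_ℚ V = [E:ℚ] · m`, `m ≥ 3` (`exists_three_le_finrank_eq_mul`), `[E:ℚ] ≥ 2` because `r ∉ ℚ`, so
`[E:ℚ]` is prime and every `s ∈ E` is a rational polynomial in `r` (`exists_eq_aeval_of_finrank_prime`).
[cite: Vangeemen2008, Lemma 3.2] [cite: Zarhin1983HodgeGroupsK3, Thm. 1.5.1] -/
theorem exists_eq_aeval_of_totallyReal (hirr : H.IsIrreducible) (hK3 : H.IsOfK3Type)
    (ψ : H.Polarization) (hF : IsField H.endAlg)
    (hreal : ∀ (φ : H.endAlg →+* ℂ) (a : H.endAlg), starRingEnd ℂ (φ a) = φ a)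
    (hV : ∀ d m : ℕ, 2 ≤ d → 3 ≤ m → Module.finrank ℚ V = d * m → d.Prime)
    {r : H.endAlg} (hr : r ∉ (⊥ : Subalgebra ℚ H.endAlg)) (s : H.endAlg) :
    ∃ P : ℚ[X], s = aeval r P := by
  haveI := isDomain_endAlg_of_isField hF
  haveI : Module.Finite ℚ H.endAlg := finiteDimensional_endAlg H
  haveI : Nontrivial V := hirr.nontrivial
  obtain ⟨m, hm, hdim⟩ := exists_three_le_finrank_eq_mul hirr hK3 ψ hF hreal
  have hd2 : 2 ≤ Module.finrank ℚ H.endAlg := by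
    by_contra hlt
    have h1 := one_le_finrank_endAlg H
    have hd1 : Module.finrank ℚ H.endAlg = 1 := by omega
    exact hr (by rw [Subalgebra.bot_eq_top_of_finrank_eq_one hd1]; exact Algebra.mem_top)
  exact exists_eq_aeval_of_finrank_prime (hV _ m hd2 hm hdim) hr s

end Abstract

variable {S : SchemeOver ℂ}

/-! ### `N¹`-stability and the `N¹`-stable form of the rung F4 -/

/-- **A rational, type-preserving endomorphism of `H²(S(ℂ); ℂ)` maps `N = N¹H²` into itself** (`S`
smooth projective): `N` is spanned by rational classes (`supportedClasses_eq_span`), which are of type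
`(1,1)`, and the image of a rational `(1,1)`-class is a rational `(1,1)`-class, in `N` by Lefschetz
`(1,1)` (`lefschetzOneOne_rational_holds`). [cite: VoisinHodgeI2002, Thm. 11.30] -/
theorem mapsTo_algebraicClasses_one (hS : IsSmoothProjective 2 S)
    (e : complexBetti S (2 * 1) →ₗ[ℂ] complexBetti S (2 * 1))
    (he_rat : ∀ y, IsRationalClass y → IsRationalClass (e y))
    (he_typ : ∀ (i j : ℕ) y, IsOfHodgeType 2 S (2 * 1) i j y → IsOfHodgeType 2 S (2 * 1) i j (e y)) :
    ∀ d ∈ algebraicClasses S 1, e d ∈ algebraicClasses S 1 := by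
  intro d hd
  have hspan := span_isRationalClass_eq_top_of_isSmoothProjective_holds.supportedClasses_eq_span
    hS (2 * 1) 1
  have hd' : d ∈ Submodule.span ℂ {c : complexBetti S (2 * 1) |
      IsRationalClass c ∧ c ∈ supportedClasses S (2 * 1) 1} := by
    rw [← hspan]; exact hd
  clear hd
  induction hd' using Submodule.span_induction with
  | mem c hc =>
    exact lefschetzOneOne_rational_holds hS (e c) (he_rat c hc.1)
      (he_typ 1 1 c (isOfHodgeType_of_mem_algebraicClasses_of_isSmoothProjective hS 1 hc.2))
  | zero => rw [map_zero]; exact Submodule.zero_mem _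
  | add c c' _ _ hc hc' => rw [map_add]; exact Submodule.add_mem _ hc hc'
  | smul t c _ hc => rw [map_smul]; exact Submodule.smul_mem _ _ hc

/-- **Rung F4 `SquareOfGenerator` with `N¹`-STABILITY in place of "kills `N¹`"**: for a smooth
projective surface `S`, an orientation family `μ`, and an endomorphism `e` of `H²(S(ℂ); ℂ)` mapping
`N = N¹H²` into itself and induced by an algebraic class on `S × S`, if every rational Hodge
endomorphism killing `N` with image `⊥ N` is a rational polynomial in `e` on `T`
(`TranscendentalEndomorphismsGeneratedBy S e`), then `HodgeConjectureFor 4 (S ⊗ S)`: `Σ aᵢ eⁱ` is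
`N`-stable (`Module.End.pow_apply_mem_of_forall_mem`) and cycle-induced
(`SquareOfGenerator.exists_algebraicClass_pow_of_corrFst`), so
`CycleInducedSector.hodgeConjectureFor_square_of_cycleInducedSector` applies.
[cite: Varesco2023, §2 (p. 8)] [cite: Fulton1998, §16.1 Prop. 16.1.1] -/
theorem hodgeConjectureFor_square_of_generatedBy_of_mapsTo (μ : OrientationFamily)
    (hS : IsSmoothProjective 2 S) (e : complexBetti S (2 * 1) →ₗ[ℂ] complexBetti S (2 * 1))
    (he_N : ∀ d ∈ algebraicClasses S 1, e d ∈ algebraicClasses S 1)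
    (he_cyc : ∃ γ ∈ algebraicClasses (S ⊗ S) 2, ∀ y : complexBetti S (2 * 1), e y = Corr[μ, hS ; γ, y])
    (hgen : TranscendentalEndomorphismsGeneratedBy S e) :
    HodgeConjectureFor 4 (S ⊗ S) := by
  refine CycleInducedSector.hodgeConjectureFor_square_of_cycleInducedSector μ hS
    fun f hf₁ hf₂ hf₃ hf₄ ↦ ?_
  obtain ⟨n, a, ha⟩ := hgen f hf₁ hf₂ hf₃ hf₄
  have hpow := fun i : ℕ ↦ SquareOfGenerator.exists_algebraicClass_pow_of_corrFst μ hS e he_cyc i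
  choose γ hγalg hγ using hpow
  refine ⟨∑ i : Fin n, ((a i : ℚ) : ℂ) • e ^ (i : ℕ), fun d hd ↦ ?_,
    ⟨∑ i : Fin n, ((a i : ℚ) : ℂ) • γ i,
      Submodule.sum_mem _ fun i _ ↦ Submodule.smul_mem _ _ (hγalg i), fun y ↦ ?_⟩, fun y hy ↦ ?_⟩
  · rw [LinearMap.sum_apply]
    refine Submodule.sum_mem _ fun i _ ↦ ?_
    rw [LinearMap.smul_apply]
    exact Submodule.smul_mem _ _ (Module.End.pow_apply_mem_of_forall_mem _ he_N d hd)
  · rw [LinearMap.sum_apply, map_sum, map_sum]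
    refine Finset.sum_congr rfl fun i _ ↦ ?_
    rw [LinearMap.smul_apply, map_smul, map_smul, hγ]
  · rw [ha y hy, LinearMap.sum_apply]
    refine Finset.sum_congr rfl fun i _ ↦ ?_
    rw [LinearMap.smul_apply]


/-! ### Appended (gen 8, part 5): the DEGREE form of the abstract generation lemma

`exists_eq_aeval_of_totallyReal` needs `[E:ℚ]` prime; the following variant trades primality for the
DEGREE `k` of the minimal polynomial of `r`: `[ℚ(r):ℚ] = k` divides `[E:ℚ]`, `[E:ℚ] · m = dim_ℚ V` with
`m ≥ 3` (van Geemen), so if `dim_ℚ V ≠ k · j · m` for all `j ≥ 2`, `m ≥ 3` then `[E:ℚ(r)] = 1`, i.e.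
`E = ℚ(r) = ℚ[r]`. For K3 surfaces (`dim V = 22 - ρ`): `6k > 22 - ρ(S)` suffices; e.g. a CUBIC eigenvalue
at `ρ = 10` (van Geemen–Schütt's `ℚ(ζ₉ + ζ₉⁻¹)` type) or a QUINTIC one at `ρ = 2` (`ℚ(ζ₁₁ + ζ₁₁⁻¹)`),
where the prime form is silent (`12 = 4·3`, `20 = 4·5`). -/

section AbstractDegree

variable {V : Type u} [AddCommGroup V] [Module ℚ V] [Module.Finite ℚ V] {H : HodgeStructure V 2}

/-- **`End_Hdg(V) = ℚ[r]` when the degree of `r` leaves no room**: for `H` irreducible of K3 type,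
polarized, with `E = End_Hdg(V)` a totally real field, and `r ∈ E` whose minimal polynomial over `ℚ` has
degree `k`: if `dim_ℚ V ≠ k · j · m` for all `j ≥ 2`, `m ≥ 3`, then every `s ∈ E` is a rational
polynomial in `r`. Proof: `[ℚ⟮r⟯:ℚ] = k` (`IntermediateField.adjoin.finrank`), tower law, van Geemen's
`dim_ℚ V = [E:ℚ] · m` with `m ≥ 3` (`exists_three_le_finrank_eq_mul`) force `[E:ℚ⟮r⟯] = 1`, so
`ℚ⟮r⟯ = ⊤ = ℚ[r]` (`r` algebraic). [cite: Vangeemen2008, Lemma 3.2] [cite: Zarhin1983HodgeGroupsK3, Thm. 1.5.1] -/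
theorem exists_eq_aeval_of_totallyReal_of_natDegree (hirr : H.IsIrreducible) (hK3 : H.IsOfK3Type)
    (ψ : H.Polarization) (hF : IsField H.endAlg)
    (hreal : ∀ (φ : H.endAlg →+* ℂ) (a : H.endAlg), starRingEnd ℂ (φ a) = φ a)
    {r : H.endAlg} {k : ℕ} (hk : (minpoly ℚ r).natDegree = k)
    (hV : ∀ j m : ℕ, 2 ≤ j → 3 ≤ m → Module.finrank ℚ V ≠ k * j * m) (s : H.endAlg) :
    ∃ P : ℚ[X], s = aeval r P := by
  classical
  letI : Field H.endAlg := hF.toField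
  haveI : Module.Finite ℚ H.endAlg := finiteDimensional_endAlg H
  haveI : Nontrivial V := hirr.nontrivial
  obtain ⟨m, hm, hdim⟩ := exists_three_le_finrank_eq_mul hirr hK3 ψ hF hreal
  have hint : IsIntegral ℚ r := Algebra.IsIntegral.isIntegral r
  set K : IntermediateField ℚ H.endAlg := IntermediateField.adjoin ℚ {r} with hKdef
  have hKk : Module.finrank ℚ K = k := by rw [hKdef, IntermediateField.adjoin.finrank hint, hk]
  have htower : Module.finrank ℚ K * Module.finrank K H.endAlg = Module.finrank ℚ H.endAlg :=
    Module.finrank_mul_finrank ℚ K H.endAlg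
  have hj1 : Module.finrank K H.endAlg = 1 := by
    have hpos : 0 < Module.finrank K H.endAlg := Module.finrank_pos
    by_contra hne
    have hj2 : 2 ≤ Module.finrank K H.endAlg := by omega
    exact hV _ m hj2 hm (by rw [hdim, ← htower, hKk])
  have htop : K = ⊤ := IntermediateField.finrank_eq_one_iff_eq_top.1 hj1
  have hs : s ∈ K.toSubalgebra := by
    rw [htop]
    exact Algebra.mem_top
  rw [hKdef, IntermediateField.adjoin_simple_toSubalgebra_of_isAlgebraic hint.isAlgebraic,
    Algebra.adjoin_singleton_eq_range_aeval, AlgHom.mem_range] at hs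
  obtain ⟨P, hP⟩ := hs
  exact ⟨P, hP.symm⟩

end AbstractDegree

end Summit.HodgeConjecture.HodgeConjecture.Theorems.MarkmanPartnerTransport.OneCycle

end
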